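import Summits.QuantumFields.QCD.Theorems.WilsonMobilityGapMobilityGapSketchDeepWindowAudit

/-!
# `stub_deepWindowAt` (skeleton v6, line `Sketch`, crux stmt-QuantumFields-9150) — reduction to WEGNER / density-of-states form
# (part 2 of 2; registered sub-goal `deepWindowLaw_of_crossingDOSLaw_three`)

Stub-worker W4 text (wave 5), landed by the lead seat prover-line-stmt-QuantumFields-9150-c4-0.  Via the landed coarea line of
crux `TipPricing` (`stub_coareaPointwise`, `stub_countMeasurable`, `stub_coareaExpectation`), exactly as `…SketchWindowDOS.lean`
did for two flavours: one generic transfer lemma (`countIntegral_le_of_DOS`) bounding the phase-quenched integral of any count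
dominated by the number of real eigenvalues of `D_W(U,0,1)` in an open window `(lo, hi)` by the `s`-integrated zero-window
level count of the HERMITIAN Wilson operator `γ₅ D_W(U,−s,1)` over `s ∈ (lo, hi)`; its instances — DEEP alone (crossing
masses in the gap region, `s ∈ (−1, −max t)`), WINDOW alone (`s ∈ (−max t, −min t)`), DEEP + WINDOW at once
(`s ∈ (−1, −min t)`, using the structure lemma of part 1); the normalised form; the form along a three-flavour datum; and the
law-level implication `deepWindowLaw_of_crossingDOSLaw_three` — the Hermitian entrance of skeleton v6 for `N_f = 3`, the
analogue of `windowLaw_of_windowDOSLaw_two`.  So `stub_deepWindowAt` hinges on a PHASE-QUENCHED WEGNER/LIFSHITZ ESTIMATE for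
`γ₅ D_W(U,m,1)` at bare masses in the gap region above the line's threshold, at the scheme's own volume.
-/

noncomputable section

namespace Summit.QuantumFields.QCD.Theorems.MobilityGapSketch

open scoped BigOperators Topology
open MeasureTheory Filter Set
open Literature.MathematicalPhysics.QuantumFieldTheory Literature.MathematicalPhysics.QuantumLattice
  Literature.Probability.LatticeModels

variable {N : ℕ} [NeZero N]

/-! ### §R Reduction to Wegner (density-of-states) form via the landed coarea line -/

/-- R0 (transfer lemma: one torus, one coupling, one triple, one open window `(lo, hi)` of eigenvalue positions).
If a non-negative function `C` of the gauge field is dominated by the number of real eigenvalues of `D_W(U,0,1)` in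
`(lo, hi)`, and the `s`-integrated phase-quenched (weight `Π_f |det D_W(t_f)|`) zero-window level count of the
Hermitian Wilson operator `γ₅ D_W(U,−s,1)` over `s ∈ (lo, hi)` is `≤ 2η·B` for all small `η > 0` (`B ≥ 0`), then the
phase-quenched integral of `C` is `≤ B`.  (Coarea inequality of the landed `TipPricing` line — `stub_coareaPointwise`,
`stub_countMeasurable`, `stub_coareaExpectation` — with the slack sent to `0`; an empty window forces `C = 0`.) -/
theorem countIntegral_le_of_DOS (β : ℝ) (t : Fin 3 → ℝ) (lo hi B : ℝ) (hB : 0 ≤ B)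
    (C : GaugeConfig 4 N (Matrix.specialUnitaryGroup (Fin 3) ℂ) → ℝ) (hC0 : ∀ U, 0 ≤ C U)
    (hC : ∀ U, C U ≤ ((wilsonDirac (fundamentalRep (Fin 3)) U 0 1).charpoly.roots.countP
      (fun z : ℂ => z.im = 0 ∧ lo < z.re ∧ z.re < hi) : ℝ))
    (hDOS : ∃ η₀ : ℝ, 0 < η₀ ∧ ∀ η : ℝ, 0 < η → η < η₀ →
      (∫ s in lo..hi, ∫ U : GaugeConfig 4 N (Matrix.specialUnitaryGroup (Fin 3) ℂ),
          ((spinorLift gammaFive * wilsonDirac (fundamentalRep (Fin 3)) U (-s) 1).charpoly.roots.countP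
              (fun z : ℂ => |z.re| < η) : ℝ) *
            ∏ f : Fin 3, ‖fermionDet (wilsonDirac (fundamentalRep (Fin 3)) U (t f) 1)‖
          ∂(wilsonMeasure (d := 4) (L := N) (fundamentalRep (Fin 3)) β)) ≤ 2 * η * B) :
    (∫ U : GaugeConfig 4 N (Matrix.specialUnitaryGroup (Fin 3) ℂ),
        C U * ∏ f : Fin 3, ‖fermionDet (wilsonDirac (fundamentalRep (Fin 3)) U (t f) 1)‖
        ∂(wilsonMeasure (d := 4) (L := N) (fundamentalRep (Fin 3)) β)) ≤ B := by
  classical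
  obtain ⟨η₀, hη₀, hD⟩ := hDOS
  -- the dominating window integrand is integrable (measurable, bounded by `12 N⁴`, times the integrable weight)
  have hKm : Measurable fun U : GaugeConfig 4 N (Matrix.specialUnitaryGroup (Fin 3) ℂ) =>
      (((wilsonDirac (fundamentalRep (Fin 3)) U 0 1).charpoly.roots.countP
        (fun z : ℂ => z.im = 0 ∧ lo < z.re ∧ z.re < hi) : ℕ) : ℝ) :=
    (measurable_from_nat (f := (Nat.cast : ℕ → ℝ))).comp
      (measurable_countP_charpoly_roots_window
        (continuous_wilsonDirac (fundamentalRep (Fin 3)) (continuous_fundamentalRep (Fin 3)) 0 1) lo hi)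
  have hKle : ∀ U : GaugeConfig 4 N (Matrix.specialUnitaryGroup (Fin 3) ℂ),
      ‖(((wilsonDirac (fundamentalRep (Fin 3)) U 0 1).charpoly.roots.countP
        (fun z : ℂ => z.im = 0 ∧ lo < z.re ∧ z.re < hi) : ℕ) : ℝ)‖ ≤
        Fintype.card (TorusSite 4 N × Fin 3 × Fin 4) := by
    intro U
    have h1 := Multiset.countP_le_card (fun z : ℂ => z.im = 0 ∧ lo < z.re ∧ z.re < hi)
      (wilsonDirac (fundamentalRep (Fin 3)) U 0 1).charpoly.roots
    have h2 := Polynomial.card_roots' (wilsonDirac (fundamentalRep (Fin 3)) U 0 1).charpoly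
    rw [Matrix.charpoly_natDegree_eq_dim] at h2
    rw [Real.norm_eq_abs, abs_of_nonneg (Nat.cast_nonneg _)]
    exact_mod_cast h1.trans h2
  have hKwi : Integrable (fun U : GaugeConfig 4 N (Matrix.specialUnitaryGroup (Fin 3) ℂ) =>
      (((wilsonDirac (fundamentalRep (Fin 3)) U 0 1).charpoly.roots.countP
        (fun z : ℂ => z.im = 0 ∧ lo < z.re ∧ z.re < hi) : ℕ) : ℝ) *
        ∏ f : Fin 3, ‖fermionDet (wilsonDirac (fundamentalRep (Fin 3)) U (t f) 1)‖)
      (wilsonMeasure (d := 4) (L := N) (fundamentalRep (Fin 3)) β) := by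
    refine (integrable_norm_det_diracMatrix_mul β t _ hKm.aestronglyMeasurable hKle).congr
      (Eventually.of_forall fun U => ?_)
    change ‖(diracMatrix U t).det‖ * _ = _
    rw [norm_det_diracMatrix, mul_comm]
  set w : GaugeConfig 4 N (Matrix.specialUnitaryGroup (Fin 3) ℂ) → ℝ := fun U =>
    ∏ f : Fin 3, ‖fermionDet (wilsonDirac (fundamentalRep (Fin 3)) U (t f) 1)‖ with hw
  have hwc : Continuous w := by
    have : w = fun U => ‖(diracMatrix U t).det‖ := funext fun U => (norm_det_diracMatrix U t).symm
    rw [this]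
    exact (continuous_det_diracMatrix t).norm
  have hw0 : ∀ U, 0 ≤ w U := fun U => Finset.prod_nonneg fun f _ => norm_nonneg _
  -- `∫ C w ≤ ∫ #window · w`
  have hmono : (∫ U, C U * w U ∂(wilsonMeasure (d := 4) (L := N) (fundamentalRep (Fin 3)) β)) ≤
      ∫ U, (((wilsonDirac (fundamentalRep (Fin 3)) U 0 1).charpoly.roots.countP
        (fun z : ℂ => z.im = 0 ∧ lo < z.re ∧ z.re < hi) : ℕ) : ℝ) * w U
        ∂(wilsonMeasure (d := 4) (L := N) (fundamentalRep (Fin 3)) β) :=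
    integral_mono_of_nonneg (Eventually.of_forall fun U => mul_nonneg (hC0 U) (hw0 U)) hKwi
      (Eventually.of_forall fun U => mul_le_mul_of_nonneg_right (hC U) (hw0 U))
  refine hmono.trans ?_
  rcases lt_or_ge lo hi with hlt | hle
  · -- non-degenerate window: coarea inequality, then `δ → 0`
    have hco := Summit.QuantumFields.QCD.Cruxes.TipPricing.HermitianFlowCoarea.stub_coareaExpectation
      Summit.QuantumFields.QCD.Cruxes.TipPricing.HermitianFlowCoarea.stub_coareaPointwise
      Summit.QuantumFields.QCD.Cruxes.TipPricing.HermitianFlowCoarea.stub_countMeasurable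
      N β w hwc hw0 _ _ hlt
    refine le_of_forall_pos_lt_add fun δ hδ => ?_
    obtain ⟨η₁, hη₁, hco'⟩ := hco (δ / 2) (half_pos hδ)
    set η := min η₀ η₁ / 2 with hη
    have hηpos : 0 < η := by positivity
    have hη0 : η < η₀ := by
      have := min_le_left η₀ η₁; rw [hη]; linarith
    have hη1 : η < η₁ := by
      have := min_le_right η₀ η₁; rw [hη]; linarith
    have h1 := hco' η hηpos hη1
    have h2 : (∫ s in lo..hi, ∫ U : GaugeConfig 4 N (Matrix.specialUnitaryGroup (Fin 3) ℂ),
        ((spinorLift gammaFive * wilsonDirac (fundamentalRep (Fin 3)) U (-s) 1).charpoly.roots.countP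
            (fun z : ℂ => |z.re| < η) : ℝ) * w U
        ∂(wilsonMeasure (d := 4) (L := N) (fundamentalRep (Fin 3)) β)) ≤ 2 * η * B := hD η hηpos hη0
    have h3 : 2 * η * (∫ U, (((wilsonDirac (fundamentalRep (Fin 3)) U 0 1).charpoly.roots.countP
        (fun z : ℂ => z.im = 0 ∧ lo < z.re ∧ z.re < hi) : ℕ) : ℝ) * w U
        ∂(wilsonMeasure (d := 4) (L := N) (fundamentalRep (Fin 3)) β)) ≤ 2 * η * (B + δ / 2) := by
      linarith
    have h4 := le_of_mul_le_mul_left h3 (by positivity)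
    linarith
  · -- empty window (`hi ≤ lo`): the window count vanishes and `0 ≤ B`
    have hK0 : ∀ U : GaugeConfig 4 N (Matrix.specialUnitaryGroup (Fin 3) ℂ),
        (wilsonDirac (fundamentalRep (Fin 3)) U 0 1).charpoly.roots.countP
          (fun z : ℂ => z.im = 0 ∧ lo < z.re ∧ z.re < hi) = 0 := fun U => by
      rw [Multiset.countP_eq_zero]
      rintro z - ⟨-, h1, h2⟩
      linarith
    calc (∫ U, (((wilsonDirac (fundamentalRep (Fin 3)) U 0 1).charpoly.roots.countP
          (fun z : ℂ => z.im = 0 ∧ lo < z.re ∧ z.re < hi) : ℕ) : ℝ) * w U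
          ∂(wilsonMeasure (d := 4) (L := N) (fundamentalRep (Fin 3)) β))
        = ∫ U : GaugeConfig 4 N (Matrix.specialUnitaryGroup (Fin 3) ℂ), (0 : ℝ)
          ∂(wilsonMeasure (d := 4) (L := N) (fundamentalRep (Fin 3)) β) :=
          integral_congr_ae (Eventually.of_forall fun U => by simp only [hK0 U, Nat.cast_zero, zero_mul])
      _ = 0 := integral_zero _ _
      _ ≤ B := hB

/-- R1 (DEEP alone ⇐ deep-DOS).  The phase-quenched expected number of DEEP modes (real eigenvalues of `D_W(U,0,1)`
below all the `−t_f`) is `≤ B` as soon as the `s`-integrated phase-quenched zero-window DOS of `γ₅ D_W(U,−s,1)` over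
the GAP REGION of eigenvalue positions `s ∈ (−1, −max_f t_f)` (crossing bare masses `−s ∈ (max t, 1)`) is `≤ 2η·B` for
small `η`.  (Deep = `Re z < −max t`, and real roots have `Re z ≥ 0 > −1`; for `−s ∈ (0,1)` the Hermitian operator has
no spectrum in `(−(−s), −s)` by the landed `le_abs_re_of_mem_roots_hermitianWilson`, so only `s ∈ (−η, −max t)` is charged.) -/
theorem deepIntegral_le_of_deepDOS (β : ℝ) (t : Fin 3 → ℝ) (B : ℝ) (hB : 0 ≤ B)
    (hDOS : ∃ η₀ : ℝ, 0 < η₀ ∧ ∀ η : ℝ, 0 < η → η < η₀ →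
      (∫ s in (-1 : ℝ)..(-Finset.univ.sup' Finset.univ_nonempty t),
          ∫ U : GaugeConfig 4 N (Matrix.specialUnitaryGroup (Fin 3) ℂ),
            ((spinorLift gammaFive * wilsonDirac (fundamentalRep (Fin 3)) U (-s) 1).charpoly.roots.countP
                (fun z : ℂ => |z.re| < η) : ℝ) *
              ∏ f : Fin 3, ‖fermionDet (wilsonDirac (fundamentalRep (Fin 3)) U (t f) 1)‖
            ∂(wilsonMeasure (d := 4) (L := N) (fundamentalRep (Fin 3)) β)) ≤ 2 * η * B) :
    (∫ U : GaugeConfig 4 N (Matrix.specialUnitaryGroup (Fin 3) ℂ),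
        ((wilsonDirac (fundamentalRep (Fin 3)) U 0 1).charpoly.roots.countP
            (fun z : ℂ => z.im = 0 ∧ ∀ f, z.re < -t f) : ℝ) *
          ∏ f : Fin 3, ‖fermionDet (wilsonDirac (fundamentalRep (Fin 3)) U (t f) 1)‖
        ∂(wilsonMeasure (d := 4) (L := N) (fundamentalRep (Fin 3)) β)) ≤ B := by
  classical
  refine countIntegral_le_of_DOS β t (-1) _ B hB _ (fun U => Nat.cast_nonneg _) (fun U => ?_) hDOS
  have heq : (wilsonDirac (fundamentalRep (Fin 3)) U 0 1).charpoly.roots.countP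
        (fun z : ℂ => z.im = 0 ∧ ∀ f, z.re < -t f) =
      (wilsonDirac (fundamentalRep (Fin 3)) U 0 1).charpoly.roots.countP
        (fun z : ℂ => z.im = 0 ∧ -1 < z.re ∧ z.re < -Finset.univ.sup' Finset.univ_nonempty t) := by
    refine Multiset.countP_congr rfl fun z hz => propext ⟨fun h => ⟨h.1, ?_, ?_⟩, fun h => ⟨h.1, ?_⟩⟩
    · have := (ExtinctionBuildsQCD.Negative.re_mem_Icc_of_real_root U hz h.1).1; linarith
    · exact (forall_lt_neg_iff_lt_neg_sup' t z.re).1 h.2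
    · exact (forall_lt_neg_iff_lt_neg_sup' t z.re).2 h.2.2
  rw [heq]

/-- R1 (WINDOW alone ⇐ window-DOS; the `N_f = 3` copy of `windowIntegral_le_of_windowDOS`).  The phase-quenched
expected number of WINDOW modes is `≤ B` as soon as the `s`-integrated phase-quenched zero-window DOS of
`γ₅ D_W(U,−s,1)` across the spread window `s ∈ (−max_f t_f, −min_f t_f)` is `≤ 2η·B` for small `η`. -/
theorem spreadIntegral_le_of_windowDOS (β : ℝ) (t : Fin 3 → ℝ) (B : ℝ) (hB : 0 ≤ B)
    (hDOS : ∃ η₀ : ℝ, 0 < η₀ ∧ ∀ η : ℝ, 0 < η → η < η₀ →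
      (∫ s in (-Finset.univ.sup' Finset.univ_nonempty t)..(-Finset.univ.inf' Finset.univ_nonempty t),
          ∫ U : GaugeConfig 4 N (Matrix.specialUnitaryGroup (Fin 3) ℂ),
            ((spinorLift gammaFive * wilsonDirac (fundamentalRep (Fin 3)) U (-s) 1).charpoly.roots.countP
                (fun z : ℂ => |z.re| < η) : ℝ) *
              ∏ f : Fin 3, ‖fermionDet (wilsonDirac (fundamentalRep (Fin 3)) U (t f) 1)‖
            ∂(wilsonMeasure (d := 4) (L := N) (fundamentalRep (Fin 3)) β)) ≤ 2 * η * B) :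
    (∫ U : GaugeConfig 4 N (Matrix.specialUnitaryGroup (Fin 3) ℂ),
        ((wilsonDirac (fundamentalRep (Fin 3)) U 0 1).charpoly.roots.countP
            (fun z : ℂ => z.im = 0 ∧ (∃ f, z.re < -t f) ∧ ∃ g, -t g < z.re) : ℝ) *
          ∏ f : Fin 3, ‖fermionDet (wilsonDirac (fundamentalRep (Fin 3)) U (t f) 1)‖
        ∂(wilsonMeasure (d := 4) (L := N) (fundamentalRep (Fin 3)) β)) ≤ B := by
  classical
  refine countIntegral_le_of_DOS β t _ _ B hB _ (fun U => Nat.cast_nonneg _) (fun U => ?_) hDOS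
  have heq : (wilsonDirac (fundamentalRep (Fin 3)) U 0 1).charpoly.roots.countP
        (fun z : ℂ => z.im = 0 ∧ (∃ f, z.re < -t f) ∧ ∃ g, -t g < z.re) =
      (wilsonDirac (fundamentalRep (Fin 3)) U 0 1).charpoly.roots.countP
        (fun z : ℂ => z.im = 0 ∧ -Finset.univ.sup' Finset.univ_nonempty t < z.re ∧
          z.re < -Finset.univ.inf' Finset.univ_nonempty t) :=
    Multiset.countP_congr rfl fun z _ =>
      propext (and_congr_right fun _ => exists_lt_neg_and_exists_neg_lt_iff t z.re)
  rw [heq]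

/-- R1 (DEEP + WINDOW at once ⇐ crossing-DOS).  Since `#deep + #window ≤ #{Im z = 0, ∃ f, Re z < −t_f}`
`= #{Im z = 0, −1 < Re z < −min_f t_f}` on the real spectrum of `D_W(U,0,1)` (A5, `Re z ≥ 0`), the phase-quenched
integral of the v6 integrand is `≤ B` as soon as the `s`-integrated phase-quenched zero-window DOS of `γ₅ D_W(U,−s,1)`
over ALL eigenvalue positions `s ∈ (−1, −min_f t_f)` (crossing bare masses above `min t`) is `≤ 2η·B` for small `η`.
By additivity of the `s`-integral this hypothesis is "deep-DOS + window-DOS" of the two previous lemmas. -/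
theorem deepWindowIntegral_le_of_crossingDOS (β : ℝ) (t : Fin 3 → ℝ) (B : ℝ) (hB : 0 ≤ B)
    (hDOS : ∃ η₀ : ℝ, 0 < η₀ ∧ ∀ η : ℝ, 0 < η → η < η₀ →
      (∫ s in (-1 : ℝ)..(-Finset.univ.inf' Finset.univ_nonempty t),
          ∫ U : GaugeConfig 4 N (Matrix.specialUnitaryGroup (Fin 3) ℂ),
            ((spinorLift gammaFive * wilsonDirac (fundamentalRep (Fin 3)) U (-s) 1).charpoly.roots.countP
                (fun z : ℂ => |z.re| < η) : ℝ) *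
              ∏ f : Fin 3, ‖fermionDet (wilsonDirac (fundamentalRep (Fin 3)) U (t f) 1)‖
            ∂(wilsonMeasure (d := 4) (L := N) (fundamentalRep (Fin 3)) β)) ≤ 2 * η * B) :
    (∫ U : GaugeConfig 4 N (Matrix.specialUnitaryGroup (Fin 3) ℂ),
        (((wilsonDirac (fundamentalRep (Fin 3)) U 0 1).charpoly.roots.countP
            (fun z : ℂ => z.im = 0 ∧ ∀ f, z.re < -t f) : ℝ) +
          ((wilsonDirac (fundamentalRep (Fin 3)) U 0 1).charpoly.roots.countP
            (fun z : ℂ => z.im = 0 ∧ (∃ f, z.re < -t f) ∧ ∃ g, -t g < z.re) : ℝ)) *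
          ∏ f : Fin 3, ‖fermionDet (wilsonDirac (fundamentalRep (Fin 3)) U (t f) 1)‖
        ∂(wilsonMeasure (d := 4) (L := N) (fundamentalRep (Fin 3)) β)) ≤ B := by
  classical
  refine countIntegral_le_of_DOS β t (-1) _ B hB _ (fun U => by positivity) (fun U => ?_) hDOS
  have h := countP_deep_add_countP_spread_le_countP_exists (wilsonDirac (fundamentalRep (Fin 3)) U 0 1).charpoly.roots t
  have heq : (wilsonDirac (fundamentalRep (Fin 3)) U 0 1).charpoly.roots.countP
        (fun z : ℂ => z.im = 0 ∧ ∃ f, z.re < -t f) =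
      (wilsonDirac (fundamentalRep (Fin 3)) U 0 1).charpoly.roots.countP
        (fun z : ℂ => z.im = 0 ∧ -1 < z.re ∧ z.re < -Finset.univ.inf' Finset.univ_nonempty t) := by
    refine Multiset.countP_congr rfl fun z hz => propext ⟨fun h => ⟨h.1, ?_, ?_⟩, fun h => ⟨h.1, ?_⟩⟩
    · have := (ExtinctionBuildsQCD.Negative.re_mem_Icc_of_real_root U hz h.1).1; linarith
    · exact (exists_lt_neg_iff_lt_neg_inf' t z.re).1 h.2
    · exact (exists_lt_neg_iff_lt_neg_inf' t z.re).2 h.2.2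
  rw [heq] at h
  exact_mod_cast h

/-- R2 (one torus; normalised crossing-DOS form ⟹ the BODY of `stub_deepWindowAt`): if the normalised `s`-integrated
phase-quenched zero-window DOS of `γ₅ D_W(U,−s,1)` over `s ∈ (−1, −min_f t_f)` is `≤ 2η·(1/4)` for all small `η`,
the normalised expected DEEP + WINDOW count is `≤ 1/4` (`Z₊ > 0` by `integral_norm_det_diracMatrix_pos_all`). -/
theorem deepWindowBody_le_of_crossingDOS (β : ℝ) (t : Fin 3 → ℝ)
    (hDOS : ∃ η₀ : ℝ, 0 < η₀ ∧ ∀ η : ℝ, 0 < η → η < η₀ →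
      (∫ s in (-1 : ℝ)..(-Finset.univ.inf' Finset.univ_nonempty t),
          ∫ U : GaugeConfig 4 N (Matrix.specialUnitaryGroup (Fin 3) ℂ),
            ((spinorLift gammaFive * wilsonDirac (fundamentalRep (Fin 3)) U (-s) 1).charpoly.roots.countP
                (fun z : ℂ => |z.re| < η) : ℝ) *
              ∏ f : Fin 3, ‖fermionDet (wilsonDirac (fundamentalRep (Fin 3)) U (t f) 1)‖
            ∂(wilsonMeasure (d := 4) (L := N) (fundamentalRep (Fin 3)) β)) /
        (∫ U : GaugeConfig 4 N (Matrix.specialUnitaryGroup (Fin 3) ℂ),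
          ∏ f : Fin 3, ‖fermionDet (wilsonDirac (fundamentalRep (Fin 3)) U (t f) 1)‖
          ∂(wilsonMeasure (d := 4) (L := N) (fundamentalRep (Fin 3)) β)) ≤ 2 * η * (1 / 4)) :
    (∫ U : GaugeConfig 4 N (Matrix.specialUnitaryGroup (Fin 3) ℂ),
        (((wilsonDirac (fundamentalRep (Fin 3)) U 0 1).charpoly.roots.countP
            (fun z : ℂ => z.im = 0 ∧ ∀ f, z.re < -t f) : ℝ) +
          ((wilsonDirac (fundamentalRep (Fin 3)) U 0 1).charpoly.roots.countP
            (fun z : ℂ => z.im = 0 ∧ (∃ f, z.re < -t f) ∧ ∃ g, -t g < z.re) : ℝ)) *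
          ∏ f : Fin 3, ‖fermionDet (wilsonDirac (fundamentalRep (Fin 3)) U (t f) 1)‖
        ∂(wilsonMeasure (d := 4) (L := N) (fundamentalRep (Fin 3)) β)) /
      (∫ U : GaugeConfig 4 N (Matrix.specialUnitaryGroup (Fin 3) ℂ),
        ∏ f : Fin 3, ‖fermionDet (wilsonDirac (fundamentalRep (Fin 3)) U (t f) 1)‖
        ∂(wilsonMeasure (d := 4) (L := N) (fundamentalRep (Fin 3)) β)) ≤ 1 / 4 := by
  set Z := ∫ U : GaugeConfig 4 N (Matrix.specialUnitaryGroup (Fin 3) ℂ),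
    ∏ f : Fin 3, ‖fermionDet (wilsonDirac (fundamentalRep (Fin 3)) U (t f) 1)‖
    ∂(wilsonMeasure (d := 4) (L := N) (fundamentalRep (Fin 3)) β) with hZdef
  have hZeq : Z = ∫ U : GaugeConfig 4 N (Matrix.specialUnitaryGroup (Fin 3) ℂ), ‖(diracMatrix U t).det‖
      ∂(wilsonMeasure (d := 4) (L := N) (fundamentalRep (Fin 3)) β) :=
    integral_congr_ae (Eventually.of_forall fun U => (norm_det_diracMatrix U t).symm)
  have hZ : 0 < Z := by rw [hZeq]; exact integral_norm_det_diracMatrix_pos_all β t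
  rw [div_le_iff₀ hZ]
  refine deepWindowIntegral_le_of_crossingDOS β t (1 / 4 * Z) (by positivity) ?_
  obtain ⟨η₀, hη₀, hD⟩ := hDOS
  refine ⟨η₀, hη₀, fun η hη hηlt => ?_⟩
  have := hD η hη hηlt
  rw [div_le_iff₀ hZ] at this
  linarith

/-- R3 (along a free three-flavour datum).  **`stub_deepWindowAt` follows from its CROSSING-DOS FORM**: if on some
admissible volume sequence `L ≥ L⁰`, for every large `δ`, every `M > 0`, eventually in `k`, for every window triple
`t` the normalised `s`-integrated phase-quenched zero-window DOS of `γ₅ D_W(U,−s,1)` over the eigenvalue positions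
`s ∈ (−1, −min_f t_f)` — i.e. over all crossing bare masses above `min t`: the gap region `(max t, 0]` (DEEP) and the
spread window `(min t, max t)` (WINDOW) — on the torus of side `2L_k+1` at coupling `β_k` is `≤ 2η/4` for all small
`η > 0`, then the conclusion of `stub_deepWindowAt` holds for `d` (same `L`). -/
theorem deepWindowAt_of_crossingDOSAt {d : LineData 3}
    (h : ∃ L : ℕ → ℕ, Tendsto (fun k => d.a k * (L k : ℝ)) atTop atTop ∧ (∀ᶠ k in atTop, d.vfloor k ≤ L k) ∧
      ∀ᶠ δ in atTop, ∀ M : ℝ, 0 < M → ∀ᶠ k in atTop,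
        (floorSetD d δ k).Nonempty → -1 < thrD d δ k → ∀ t : Fin 3 → ℝ,
          (∀ f, thrD d δ k < t f) → (∀ f, t f ≤ thrD d δ k + d.a k * M / d.zm k) →
            ∃ η₀ : ℝ, 0 < η₀ ∧ ∀ η : ℝ, 0 < η → η < η₀ →
              (∫ s in (-1 : ℝ)..(-Finset.univ.inf' Finset.univ_nonempty t),
                  ∫ U : GaugeConfig 4 (2 * L k + 1) (Matrix.specialUnitaryGroup (Fin 3) ℂ),
                    ((spinorLift gammaFive * wilsonDirac (fundamentalRep (Fin 3)) U (-s) 1).charpoly.roots.countP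
                        (fun z : ℂ => |z.re| < η) : ℝ) *
                      ∏ f : Fin 3, ‖fermionDet (wilsonDirac (fundamentalRep (Fin 3)) U (t f) 1)‖
                    ∂(wilsonMeasure (d := 4) (L := 2 * L k + 1) (fundamentalRep (Fin 3)) (d.β k))) /
                (∫ U : GaugeConfig 4 (2 * L k + 1) (Matrix.specialUnitaryGroup (Fin 3) ℂ),
                  ∏ f : Fin 3, ‖fermionDet (wilsonDirac (fundamentalRep (Fin 3)) U (t f) 1)‖
                  ∂(wilsonMeasure (d := 4) (L := 2 * L k + 1) (fundamentalRep (Fin 3)) (d.β k))) ≤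
                2 * η * (1 / 4)) :
    ∃ L : ℕ → ℕ, Tendsto (fun k => d.a k * (L k : ℝ)) atTop atTop ∧ (∀ᶠ k in atTop, d.vfloor k ≤ L k) ∧
      ∀ᶠ δ in atTop, ∀ M : ℝ, 0 < M → ∀ᶠ k in atTop,
        (floorSetD d δ k).Nonempty → -1 < thrD d δ k → ∀ t : Fin 3 → ℝ,
          (∀ f, thrD d δ k < t f) → (∀ f, t f ≤ thrD d δ k + d.a k * M / d.zm k) →
            (∫ U : GaugeConfig 4 (2 * L k + 1) (Matrix.specialUnitaryGroup (Fin 3) ℂ),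
                (((wilsonDirac (fundamentalRep (Fin 3)) U 0 1).charpoly.roots.countP
                    (fun z : ℂ => z.im = 0 ∧ ∀ f, z.re < -t f) : ℝ) +
                  ((wilsonDirac (fundamentalRep (Fin 3)) U 0 1).charpoly.roots.countP
                    (fun z : ℂ => z.im = 0 ∧ (∃ f, z.re < -t f) ∧ ∃ g, -t g < z.re) : ℝ)) *
                  ∏ f : Fin 3, ‖fermionDet (wilsonDirac (fundamentalRep (Fin 3)) U (t f) 1)‖
                ∂(wilsonMeasure (d := 4) (L := 2 * L k + 1) (fundamentalRep (Fin 3)) (d.β k))) /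
              (∫ U : GaugeConfig 4 (2 * L k + 1) (Matrix.specialUnitaryGroup (Fin 3) ℂ),
                ∏ f : Fin 3, ‖fermionDet (wilsonDirac (fundamentalRep (Fin 3)) U (t f) 1)‖
                ∂(wilsonMeasure (d := 4) (L := 2 * L k + 1) (fundamentalRep (Fin 3)) (d.β k))) ≤ 1 / 4 := by
  obtain ⟨L, hL, hfl, hδ⟩ := h
  refine ⟨L, hL, hfl, hδ.mono fun δ hd M hM => (hd M hM).mono fun k hk hne hthr t ht₁ ht₂ => ?_⟩
  exact deepWindowBody_le_of_crossingDOS (d.β k) t (hk hne hthr t ht₁ ht₂)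

/-- R4 (law level; candidate Hermitian entrance of skeleton v6, the `N_f = 3` analogue of the registered
`windowLaw_of_windowDOSLaw_two`).  **The DEEP + WINDOW law follows from its CROSSING-DOS FORM**: if every admissible
three-flavour datum carrying a light moment satisfies the crossing-DOS law of R3, then every such datum satisfies the
conclusion of the registered stub `stub_deepWindowAt`. -/
theorem deepWindowLaw_of_crossingDOSLaw_three :
    (∀ d : LineData 3, LightMomentAt 3 d.a d.β d.s →
      ∃ L : ℕ → ℕ, Tendsto (fun k => d.a k * (L k : ℝ)) atTop atTop ∧ (∀ᶠ k in atTop, d.vfloor k ≤ L k) ∧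
        ∀ᶠ δ in atTop, ∀ M : ℝ, 0 < M → ∀ᶠ k in atTop,
          (floorSetD d δ k).Nonempty → -1 < thrD d δ k → ∀ t : Fin 3 → ℝ,
            (∀ f, thrD d δ k < t f) → (∀ f, t f ≤ thrD d δ k + d.a k * M / d.zm k) →
              ∃ η₀ : ℝ, 0 < η₀ ∧ ∀ η : ℝ, 0 < η → η < η₀ →
                (∫ s in (-1 : ℝ)..(-Finset.univ.inf' Finset.univ_nonempty t),
                    ∫ U : GaugeConfig 4 (2 * L k + 1) (Matrix.specialUnitaryGroup (Fin 3) ℂ),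
                      ((spinorLift gammaFive * wilsonDirac (fundamentalRep (Fin 3)) U (-s) 1).charpoly.roots.countP
                          (fun z : ℂ => |z.re| < η) : ℝ) *
                        ∏ f : Fin 3, ‖fermionDet (wilsonDirac (fundamentalRep (Fin 3)) U (t f) 1)‖
                      ∂(wilsonMeasure (d := 4) (L := 2 * L k + 1) (fundamentalRep (Fin 3)) (d.β k))) /
                  (∫ U : GaugeConfig 4 (2 * L k + 1) (Matrix.specialUnitaryGroup (Fin 3) ℂ),
                    ∏ f : Fin 3, ‖fermionDet (wilsonDirac (fundamentalRep (Fin 3)) U (t f) 1)‖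
                    ∂(wilsonMeasure (d := 4) (L := 2 * L k + 1) (fundamentalRep (Fin 3)) (d.β k))) ≤
                  2 * η * (1 / 4)) →
    ∀ d : LineData 3, LightMomentAt 3 d.a d.β d.s →
      ∃ L : ℕ → ℕ, Tendsto (fun k => d.a k * (L k : ℝ)) atTop atTop ∧ (∀ᶠ k in atTop, d.vfloor k ≤ L k) ∧
        ∀ᶠ δ in atTop, ∀ M : ℝ, 0 < M → ∀ᶠ k in atTop,
          (floorSetD d δ k).Nonempty → -1 < thrD d δ k → ∀ t : Fin 3 → ℝ,
            (∀ f, thrD d δ k < t f) → (∀ f, t f ≤ thrD d δ k + d.a k * M / d.zm k) →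
              (∫ U : GaugeConfig 4 (2 * L k + 1) (Matrix.specialUnitaryGroup (Fin 3) ℂ),
                  (((wilsonDirac (fundamentalRep (Fin 3)) U 0 1).charpoly.roots.countP
                      (fun z : ℂ => z.im = 0 ∧ ∀ f, z.re < -t f) : ℝ) +
                    ((wilsonDirac (fundamentalRep (Fin 3)) U 0 1).charpoly.roots.countP
                      (fun z : ℂ => z.im = 0 ∧ (∃ f, z.re < -t f) ∧ ∃ g, -t g < z.re) : ℝ)) *
                    ∏ f : Fin 3, ‖fermionDet (wilsonDirac (fundamentalRep (Fin 3)) U (t f) 1)‖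
                  ∂(wilsonMeasure (d := 4) (L := 2 * L k + 1) (fundamentalRep (Fin 3)) (d.β k))) /
                (∫ U : GaugeConfig 4 (2 * L k + 1) (Matrix.specialUnitaryGroup (Fin 3) ℂ),
                  ∏ f : Fin 3, ‖fermionDet (wilsonDirac (fundamentalRep (Fin 3)) U (t f) 1)‖
                  ∂(wilsonMeasure (d := 4) (L := 2 * L k + 1) (fundamentalRep (Fin 3)) (d.β k))) ≤ 1 / 4 := by
  intro hDOS d hd
  exact deepWindowAt_of_crossingDOSAt (hDOS d hd)

end Summit.QuantumFields.QCD.Theorems.MobilityGapSketch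

end
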